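import Literature.NumberTheory.LFunctions.ConreyIwaniec2002OddChainHolds
import Literature.NumberTheory.LFunctions.ConreyIwaniec2002PropTenOneWeak
import Literature.NumberTheory.LFunctions.ConreyIwaniec2002MeanValues
import Literature.NumberTheory.LFunctions.ConreyIwaniec2002Proofs
import HarnessLib

/-!
# Conrey–Iwaniec (2002), §10 for odd `q`: Proposition 10.1 hypothesis-free (weak exponent) and the printed §1/§10 statements modulo (9.11)

B. Conrey, H. Iwaniec, *Spacing of zeros of Hecke L-functions and the class number problem*,
Acta Arith. 103 (2002) 259–312 [held text `paper:arxiv-math_0111012`], Proposition 10.1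
(p. 21, (10.10)–(10.13)), Theorem 1.1 (p. 2, (1.20)–(1.21)), Corollary 1.3 (p. 3).

The odd-`q` chain §§5–9 is unconditional in the kernel (`ConreyIwaniec2002OddChainHolds`:
`ConreyIwaniec2002.proposition92_weak`, the principal estimate (9.12) with middle term
`(log q)^{7/2}`, and `ConreyIwaniec2002.proposition92_of_Lq`, the printed (9.12) modulo the printed
claim of (9.11)). The §10 deductions were landed earlier as implications
(`ConreyIwaniec2002.proposition101_weak_of_principalEstimate_weak`,
`conreyIwaniec2002_proposition101_of_proposition92`,
`conreyIwaniec2002_theorem11_odd_of_proposition101`,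
`conreyIwaniec2002_corollary13_odd_of_proposition101`). This file composes them, so that every
typed §1/§10 statement of the paper has ONE named declaration stating exactly what the tree holds:

* `ConreyIwaniec2002.proposition101_weak` — **Proposition 10.1 with the conclusion
  `L(1,χ) ≥ (log T)^{−2}(log q)^{−(2A+7)}`, `q` odd, NO hypothesis** (printed exponent `−(2A+6)`);
* `ConreyIwaniec2002.proposition101_of_Lq` — the typed `conreyIwaniec2002_proposition101`
  (Proposition 10.1 VERBATIM, printed exponent) modulo ONLY the (9.11) input `hLq`;
* `ConreyIwaniec2002.theorem11_odd_of_Lq` — Theorem 1.1 for odd `q` with the PRINTED exponent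
  `−(2A+6)`, modulo ONLY `hLq`;
* `ConreyIwaniec2002.corollary13_odd_of_Lq` — Corollary 1.3 for odd `q` with the PRINTED
  `(log q)^{−18}`, in the scope of the printed one-line deduction, modulo ONLY `hLq`.

HONEST LABEL for `hLq` (= the I6 skeleton's `stub_calL_le_of_small`): "if
`(log T)L(1,χ)^{1/2}(log q)^3 ≤ 1` (9.11) then `ℒ(T) ≪ L(1,χ) log q`" needs `|L′(1,χ)| ≪ log q` for
the exceptional character; located print gives `(log q)²` only (Friedlander–Iwaniec 2018) — OPEN,
not proved and not claimed here. No definition; no summit statement; nothing here bears on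
Landau–Siegel zeros beyond what CI 2002 prints for odd `q`.

«The programme SEARCHES and TYPES; no claim about Landau–Siegel zeros, Theorems 1–2 of
arXiv:2211.02515 or a repaired Margin232 until a kernel theorem says so.»

## References
* [ConreyIwaniec2002] B. Conrey, H. Iwaniec, Acta Arith. 103 (2002) 259–312, arXiv:math/0111012:
  Proposition 10.1 (10.10)–(10.13), Theorem 1.1 (1.20)–(1.21), Corollary 1.3, Proposition 9.2
  (9.12), (9.11).
* [FriedlanderIwaniec2018] J. Friedlander, H. Iwaniec, *A note on Dirichlet L-functions*, Expo.
  Math. 36 (2018) 343–350, arXiv:1701.03771 (status of the bound behind (9.11)).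
-/

noncomputable section

open scoped NumberField
open Complex

namespace Literature.NumberTheory.LFunctions

namespace ConreyIwaniec2002

open NumberField

/-! ### Proposition 10.1, weak exponent, hypothesis-free -/

/-- **CI PROPOSITION 10.1 WITH EXPONENT `−(2A+7)`, `q` ODD — UNCONDITIONAL.** "Let `A ≥ 0` and
`log T ≥ (log q)^{A+6}`. Suppose there is a set `S(T)` of points `2 ≤ t₁ < … < t_R ≤ T`, spaced by
at least one, with companions `|t_r − t′_r| ≤ π(1−α)/log t_r` (10.10), `0 < α ≤ 1`, and
`|(L(s_r) − L(s′_r))/(s_r − s′_r)| ≤ (log q)^{7/2}` (10.11). Suppose `R ≥ cT/(α(log q)^A)` (10.12).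
Then `L(1,χ) ≥ (log T)^{−2}(log q)^{−2A−6}` (10.13)" — here with `(log q)^{−(2A+7)}`, the exponent
the fact-free principal estimate `proposition92_weak` delivers; one absolute `c` outermost;
`K = ℚ(√−q)`, `q > 4` odd, `χ = (−q/·)`, `ψ ∈ Ĉℓ(K)`, `L = L(·,ψ)`. The composition of
`proposition101_weak_of_principalEstimate_weak` with `proposition92_weak`.
[cite: ConreyIwaniec2002, Proposition 10.1 (10.10)–(10.13)] -/
theorem proposition101_weak :
    ∃ c : ℝ, 0 < c ∧
    ∀ A : ℝ, 0 ≤ A →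
      ∀ (q : ℕ) [NeZero q], 4 < q → Odd q → ∀ χ : DirichletCharacter ℂ q,
        χ.IsPrimitive → χ.IsQuadratic → χ.Odd →
          ∀ (K : Type) [Field K] [NumberField K],
            Module.finrank ℚ K = 2 → NumberField.discr K = -(q : ℤ) →
              ∀ (ψ : ClassGroup (𝓞 K) →* ℂˣ) (T α : ℝ) (S : Finset ℝ) (t' : ℝ → ℝ),
                2 ≤ T → 0 < α → α ≤ 1 → Real.log q ^ (A + 6) ≤ Real.log T →
                  IsPointSet S T →
                    (∀ t ∈ S, |t - t' t| ≤ gapRadius α t) →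
                      (∀ t ∈ S, ‖dividedDifference (classGroupLFunction K ψ)
                          (1 / 2 + t * I) (1 / 2 + t' t * I)‖ ≤ Real.log q ^ ((7 : ℝ) / 2)) →
                        c * T / (α * Real.log q ^ A) ≤ (S.card : ℝ) →
                          Real.log T ^ (-(2 : ℝ)) * Real.log q ^ (-(2 * A + 7)) ≤
                            ‖χ.LFunction 1‖ :=
  proposition101_weak_of_principalEstimate_weak proposition92_weak

/-! ### The printed Proposition 10.1 / Theorem 1.1 / Corollary 1.3 (odd `q`) modulo (9.11) only -/

/-- **CI PROPOSITION 10.1 AS TYPED (`conreyIwaniec2002_proposition101`, printed exponent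
`−(2A+6)`), modulo ONLY the (9.11) input** `hLq` ("if `(log T)L(1,χ)^{1/2}(log q)^3 ≤ 1` then
`ℒ(T) ≪ L(1,χ) log q`" — OPEN in print, see the module docstring): the typed Proposition 9.2
(`proposition92_of_Lq hLq`) fed to the landed deduction
`conreyIwaniec2002_proposition101_of_proposition92`.
[cite: ConreyIwaniec2002, Proposition 10.1 (10.10)–(10.13), (9.11)] -/
theorem proposition101_of_Lq
    (hLq : ∃ C : ℝ, 0 < C ∧ ∀ (q : ℕ) [NeZero q], 4 < q → ∀ χ : DirichletCharacter ℂ q,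
      χ.IsPrimitive → χ.IsQuadratic → χ.Odd → ∀ T : ℝ, 2 ≤ T →
        Real.log T * Real.sqrt ‖χ.LFunction 1‖ * Real.log q ^ (3 : ℕ) ≤ 1 →
          calL χ T ≤ C * (‖χ.LFunction 1‖ * Real.log q)) :
    conreyIwaniec2002_proposition101 :=
  conreyIwaniec2002_proposition101_of_proposition92 (proposition92_of_Lq hLq)

/-- **CI THEOREM 1.1 FOR ODD `q` WITH THE PRINTED EXPONENT `−(2A+6)`, modulo ONLY the (9.11)
input** `hLq`: "Let `A ≥ 0` and `log T ≥ (log q)^{A+6}`. Suppose `D(α,T) ≥ cT log T/(α(log q)^A)`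
(1.20) for some `0 < α ≤ 1` … Then `L(1,χ) ≥ (log T)^{−2}(log q)^{−2A−6}` (1.21)", `q` odd (the
scope of the printed proof via Proposition 10.1); `D(α,T) = closeZeroCount (L(·,ψ)) α T`. The landed
deduction `conreyIwaniec2002_theorem11_odd_of_proposition101` at `proposition101_of_Lq hLq`. The
hypothesis-free form with `−(2A+7)` is `conreyIwaniec2002_theorem11_weak_holds`.
[cite: ConreyIwaniec2002, Theorem 1.1 (1.20)–(1.21), (9.11)] -/
theorem theorem11_odd_of_Lq
    (hLq : ∃ C : ℝ, 0 < C ∧ ∀ (q : ℕ) [NeZero q], 4 < q → ∀ χ : DirichletCharacter ℂ q,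
      χ.IsPrimitive → χ.IsQuadratic → χ.Odd → ∀ T : ℝ, 2 ≤ T →
        Real.log T * Real.sqrt ‖χ.LFunction 1‖ * Real.log q ^ (3 : ℕ) ≤ 1 →
          calL χ T ≤ C * (‖χ.LFunction 1‖ * Real.log q)) :
    ∃ c : ℝ, 0 < c ∧
      ∀ A : ℝ, 0 ≤ A →
        ∀ (q : ℕ) [NeZero q], 4 < q → Odd q → ∀ χ : DirichletCharacter ℂ q,
          χ.IsPrimitive → χ.IsQuadratic → χ.Odd →
            ∀ (K : Type) [Field K] [NumberField K],
              Module.finrank ℚ K = 2 → NumberField.discr K = -(q : ℤ) →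
                ∀ (ψ : ClassGroup (𝓞 K) →* ℂˣ) (T α : ℝ), 2 ≤ T → 0 < α → α ≤ 1 →
                  Real.log q ^ (A + 6) ≤ Real.log T →
                    c * T * Real.log T / (α * Real.log q ^ A) ≤
                        (closeZeroCount (classGroupLFunction K ψ) α T : ℝ) →
                      Real.log T ^ (-(2 : ℝ)) * Real.log q ^ (-(2 * A + 6)) ≤ ‖χ.LFunction 1‖ :=
  conreyIwaniec2002_theorem11_odd_of_proposition101 (proposition101_of_Lq hLq)

/-- **CI COROLLARY 1.3 FOR ODD `q` WITH THE PRINTED `(log q)^{−18}`, modulo ONLY the (9.11)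
input** `hLq`: "Suppose there are points `2 ≤ t₁ < … < t_R ≤ T` with `t_{r+1} − t_r ≥ 1` such that
`|L′(½ + it_r, ψ)| ≤ (log q)^{7/2}`, where `R ≫ T = exp((log q)^6)`. Then `L(1,χ) ≫ (log q)^{−18}`"
— in the scope of the printed one-line deduction from Proposition 10.1 (`A = 0`, `α = 1`,
`s′_r = s_r`; threshold constant `c₁` = the absolute constant of (10.12), implied constant `c′`).
The landed deduction `conreyIwaniec2002_corollary13_odd_of_proposition101` at
`proposition101_of_Lq hLq`. The hypothesis-free form with `(log q)^{−19}` is `corollary13_odd_weak`.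
[cite: ConreyIwaniec2002, Corollary 1.3, (9.11)] -/
theorem corollary13_odd_of_Lq
    (hLq : ∃ C : ℝ, 0 < C ∧ ∀ (q : ℕ) [NeZero q], 4 < q → ∀ χ : DirichletCharacter ℂ q,
      χ.IsPrimitive → χ.IsQuadratic → χ.Odd → ∀ T : ℝ, 2 ≤ T →
        Real.log T * Real.sqrt ‖χ.LFunction 1‖ * Real.log q ^ (3 : ℕ) ≤ 1 →
          calL χ T ≤ C * (‖χ.LFunction 1‖ * Real.log q)) :
    ∃ c₁ : ℝ, 0 < c₁ ∧ ∃ c' : ℝ, 0 < c' ∧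
      ∀ (q : ℕ) [NeZero q], 4 < q → Odd q → ∀ χ : DirichletCharacter ℂ q,
        χ.IsPrimitive → χ.IsQuadratic → χ.Odd →
          ∀ (K : Type) [Field K] [NumberField K],
            Module.finrank ℚ K = 2 → NumberField.discr K = -(q : ℤ) →
              ∀ (ψ : ClassGroup (𝓞 K) →* ℂˣ) (S : Finset ℝ),
                IsPointSet S (Real.exp (Real.log q ^ (6 : ℕ))) →
                  (∀ t ∈ S, ‖deriv (classGroupLFunction K ψ) (1 / 2 + t * I)‖ ≤
                      Real.log q ^ ((7 : ℝ) / 2)) →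
                    c₁ * Real.exp (Real.log q ^ (6 : ℕ)) ≤ (S.card : ℝ) →
                      c' * Real.log q ^ (-(18 : ℝ)) ≤ ‖χ.LFunction 1‖ :=
  conreyIwaniec2002_corollary13_odd_of_proposition101 (proposition101_of_Lq hLq)

end ConreyIwaniec2002

end Literature.NumberTheory.LFunctions

end
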